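import Summits.Ventures.HSemireg.WedgeHankelOuterFamily
import Summits.Ventures.HSemireg.WedgeHankelOuterPure

/-!
# Venture HSemireg — THE PURE PIECES OF A JOINT KERNEL: for every finite family of classes `w_N(q_c)` and every set `A` of pairs,
# **`dim (Hom(univ,|A|) ⊓ ⋂_c Kr(univ, w_N q_c, |A|) ⊓ Sp(ptype = 𝟙_A)) = 2^{|A|} − rank [H_{|A|}(q_c)]_c`** — the multilinear piece on `A` of the forms killed by the whole family
# sees exactly the rank of the family's Hankel matrices side by side (one class: L2; all classes: the Siegel ideal's `2^k − (k+1)`, L8)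

HONEST FRAMING. Part of the Lean index of the computation cell `pub-hsemireg` (seat p10 gen 23, Sunday typer «UNIFORM-IN-n»).
Finite-dimensional EXTERIOR ALGEBRA over a field ONLY: no variety, no cohomology theory, no sheaf, no Ext group, no semiregularity map;
nothing here says that HC / HC_CM / HC_AV holds; no Literature fact is declared or used.  Custodian versions as in `WedgeHankelSiegelIdeal` (1/3); the dictionary (pair type `𝟙_A` = the
Künneth piece with one degree from each factor in `A`) is QUOTED, never asserted.

WHAT IS IN THE TREE.  J1 (this seat, `WedgeHankelOuterFamily`): `finrank_iInf_Kr_w_inf_Sp_pairs_add` (the joint kernel law on every sub-box); L2 (`WedgeHankelOuterPure`): `Sp_pure_le`,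
`Sp_nonpure_le_Kr`, `finrank_inf_Sp_add_finrank_inf_Sp_not`, `proj_ptype_mem_Hom_inf_Sp_pairs`, `Hom_inf_Sp_pairs_inf_Sp_pure`, `finrank_Sp_pure`, `mem_pairs_of_ptype_eq_indicator`; H10
`proj_ptype_mem_Kr_w`; L1 `Hom_univ_inf_Sp_pairs_eq`, `card_letters_eq`; K39 `finrank_Hom_In`.
THIS FILE (namespace `Summit.Ventures.HSemireg.Wedge.HankelOuter` continued; imports J1 and L2):
* §399 `Sp_nonpure_le_Hom_iInf_Kr` (the non-pure `|A|`-forms on the letters of `A` are killed by every class), `proj_ptype_mem_Hom_iInf_Kr_w_inf_Sp_pairs` (the restricted joint kernel is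
  pair-graded), `Hom_iInf_Kr_inf_Sp_pairs_inf_Sp_pure`, `Hom_iInf_Kr_inf_Sp_pairs_inf_Sp_nonpure`, **`finrank_iInf_Kr_w_inf_Sp_pure_add_rank`** (count-free), and
  **`finrank_iInf_Kr_w_inf_Sp_pure_add`: `dim (Hom(univ,|A|) ⊓ ⋂_c Kr(univ, w_N q_c, |A|) ⊓ Sp(ptype = 𝟙_A)) + rank (hank K N |A| q) = 2^{|A|}`**, `finrank_iInf_Kr_w_inf_Sp_pure_eq`.
READING: the table of L2/L4/L5 for one class extends verbatim to finite families with the block Hankel rank in place of `rank H_k(q)`; the full-pair pieces are all of the joint kernel for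
the same trivial reason.  Nothing Ext-side.  New names only.
-/

open Module

namespace Summit.Ventures.HSemireg.Wedge.HankelOuter

open Summit.Ventures.HSemireg.Wedge Summit.Ventures.HSemireg.Wedge.Kunneth Summit.Ventures.HSemireg.Wedge.Hankel
  Summit.Ventures.HSemireg.Wedge.BasisFree Summit.Ventures.HSemireg.Wedge.HankelSiegel Summit.Ventures.HSemireg.Wedge.HankelSiegelIdeal
  Summit.Ventures.HSemireg.Wedge.KunnethKernel Summit.Ventures.HSemireg.Wedge.HankelFrameChange Summit.Ventures.HSemireg.Wedge.Weil
  Summit.Ventures.HSemireg.Wedge.HankelPairMixing Summit.Ventures.HSemireg.Wedge.HankelPairGrading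

variable (K : Type*) [Field K] {N : ℕ} {ι : Type} [Fintype ι] [DecidableEq ι]

/-! ## §399. The pure pieces of a joint kernel -/

omit [Fintype ι] [DecidableEq ι] in
/-- **the non-pure `|A|`-forms on the letters of `A` are killed by EVERY class of the box**: `Sp(|s| = |A| ∧ pairs ⊆ A ∧ ptype s ≠ 𝟙_A) ≤ Hom(univ,|A|) ⊓ ⋂_c Kr(univ, w_N q_c, |A|)`. -/
theorem Sp_nonpure_le_Hom_iInf_Kr (A : Finset (Fin N)) (q : ι → ℕ → K) :
    Sp K (fun s : Finset (In N) => (s.card = A.card ∧ ∀ i ∈ s, pr i ∈ A) ∧ ¬ ptype s = fun c => if c ∈ A then 1 else 0)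
      ≤ Hom K (In N) (Finset.univ : Finset (In N)) A.card ⊓ ⨅ c, Kr K (Finset.univ : Finset (In N)) (w K N N (q c)) A.card := by
  refine le_inf ?_ (le_iInf fun c => Sp_nonpure_le_Kr K A (w_mem_Sp_Tr K (q c)))
  rw [Hom_eq_Sp]
  exact Sp_mono fun s hs => ⟨Finset.subset_univ _, hs.1.1⟩

omit [Fintype ι] [DecidableEq ι] in
/-- the restricted joint kernel `Hom(univ,k) ⊓ ⋂_c Kr(univ, w_N q_c, k) ⊓ Sp(pairs ⊆ A)` is closed under every pair-type projection. -/
theorem proj_ptype_mem_Hom_iInf_Kr_w_inf_Sp_pairs (τ : Fin N → ℕ) (A : Finset (Fin N)) (q : ι → ℕ → K) (k : ℕ) {θ : HT K (In N)}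
    (hθ : θ ∈ Hom K (In N) (Finset.univ : Finset (In N)) k ⊓ (⨅ c, Kr K (Finset.univ : Finset (In N)) (w K N N (q c)) k) ⊓ Sp K (fun s : Finset (In N) => ∀ i ∈ s, pr i ∈ A)) :
    proj (K := K) (fun s : Finset (In N) => ptype s = τ) θ
      ∈ Hom K (In N) (Finset.univ : Finset (In N)) k ⊓ (⨅ c, Kr K (Finset.univ : Finset (In N)) (w K N N (q c)) k) ⊓ Sp K (fun s : Finset (In N) => ∀ i ∈ s, pr i ∈ A) := by
  classical
  rw [Submodule.mem_inf, Submodule.mem_inf, Submodule.mem_iInf] at hθ ⊢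
  exact ⟨⟨proj_mem_Hom K _ hθ.1.1, fun c => proj_ptype_mem_Kr_w K τ (q c) (hθ.1.2 c)⟩, Sp_mono (fun s hs => hs.1) (proj_mem_and hθ.2)⟩

omit [Fintype ι] [DecidableEq ι] in
/-- the pure piece of the restricted joint kernel is the pure piece of the joint kernel. -/
theorem Hom_iInf_Kr_inf_Sp_pairs_inf_Sp_pure (A : Finset (Fin N)) (q : ι → ℕ → K) (k : ℕ) :
    Hom K (In N) (Finset.univ : Finset (In N)) k ⊓ (⨅ c, Kr K (Finset.univ : Finset (In N)) (w K N N (q c)) k) ⊓ Sp K (fun s : Finset (In N) => ∀ i ∈ s, pr i ∈ A)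
        ⊓ Sp K (fun s : Finset (In N) => ptype s = fun c => if c ∈ A then 1 else 0)
      = Hom K (In N) (Finset.univ : Finset (In N)) k ⊓ (⨅ c, Kr K (Finset.univ : Finset (In N)) (w K N N (q c)) k)
        ⊓ Sp K (fun s : Finset (In N) => ptype s = fun c => if c ∈ A then 1 else 0) := by
  rw [inf_assoc]
  congr 1
  exact inf_eq_right.mpr (Sp_mono fun s hs => mem_pairs_of_ptype_eq_indicator hs)

omit [Fintype ι] [DecidableEq ι] in
/-- the non-pure piece of the restricted joint kernel in degree `|A|` is the whole non-pure piece of the `|A|`-forms on the letters of `A`. -/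
theorem Hom_iInf_Kr_inf_Sp_pairs_inf_Sp_nonpure (A : Finset (Fin N)) (q : ι → ℕ → K) :
    Hom K (In N) (Finset.univ : Finset (In N)) A.card ⊓ (⨅ c, Kr K (Finset.univ : Finset (In N)) (w K N N (q c)) A.card) ⊓ Sp K (fun s : Finset (In N) => ∀ i ∈ s, pr i ∈ A)
        ⊓ Sp K (fun s : Finset (In N) => ¬ ptype s = fun c => if c ∈ A then 1 else 0)
      = Hom K (In N) (Finset.univ : Finset (In N)) A.card ⊓ Sp K (fun s : Finset (In N) => ∀ i ∈ s, pr i ∈ A)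
        ⊓ Sp K (fun s : Finset (In N) => ¬ ptype s = fun c => if c ∈ A then 1 else 0) := by
  refine le_antisymm (inf_le_inf (inf_le_inf inf_le_left le_rfl) le_rfl) ?_
  have hSp : Hom K (In N) (Finset.univ : Finset (In N)) A.card ⊓ Sp K (fun s : Finset (In N) => ∀ i ∈ s, pr i ∈ A)
      ⊓ Sp K (fun s : Finset (In N) => ¬ ptype s = fun c => if c ∈ A then 1 else 0)
      = Sp K (fun s : Finset (In N) => (s.card = A.card ∧ ∀ i ∈ s, pr i ∈ A) ∧ ¬ ptype s = fun c => if c ∈ A then 1 else 0) := by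
    rw [Hom_eq_Sp, Sp_inf_Sp, Sp_inf_Sp]
    apply Sp_congr_iff
    intro s
    exact ⟨fun h => ⟨⟨h.1.1.2, h.1.2⟩, h.2⟩, fun h => ⟨⟨⟨Finset.subset_univ _, h.1.1⟩, h.1.2⟩, h.2⟩⟩
  refine le_inf (le_inf ?_ (le_trans inf_le_left inf_le_right)) inf_le_right
  rw [hSp]
  exact Sp_nonpure_le_Hom_iInf_Kr K A q

/-- **THE COUNT-FREE VALUE: `dim (Hom(univ,|A|) ⊓ ⋂_c Kr(univ, w_N q_c, |A|) ⊓ Sp(ptype = 𝟙_A)) + rank (hank K N |A| q) = dim Sp(ptype = 𝟙_A)`** (every finite family `q`, every `A`). -/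
theorem finrank_iInf_Kr_w_inf_Sp_pure_add_rank (A : Finset (Fin N)) (q : ι → ℕ → K) :
    finrank K ↥(Hom K (In N) (Finset.univ : Finset (In N)) A.card ⊓ (⨅ c, Kr K (Finset.univ : Finset (In N)) (w K N N (q c)) A.card)
        ⊓ Sp K (fun s : Finset (In N) => ptype s = fun c => if c ∈ A then 1 else 0))
      + (hank K N A.card (fun (_ : Unit) (c : ι) => q c)).rank
      = finrank K ↥(Sp K (fun s : Finset (In N) => ptype s = fun c => if c ∈ A then 1 else 0)) := by
  classical
  have h1 := finrank_inf_Sp_add_finrank_inf_Sp_not K (fun s : Finset (In N) => ptype s = fun c => if c ∈ A then 1 else 0)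
    (W := Hom K (In N) (Finset.univ : Finset (In N)) A.card ⊓ (⨅ c, Kr K (Finset.univ : Finset (In N)) (w K N N (q c)) A.card)
      ⊓ Sp K (fun s : Finset (In N) => ∀ i ∈ s, pr i ∈ A))
    (fun θ hθ => proj_ptype_mem_Hom_iInf_Kr_w_inf_Sp_pairs K _ A q A.card hθ)
  have h2 := finrank_inf_Sp_add_finrank_inf_Sp_not K (fun s : Finset (In N) => ptype s = fun c => if c ∈ A then 1 else 0)
    (W := Hom K (In N) (Finset.univ : Finset (In N)) A.card ⊓ Sp K (fun s : Finset (In N) => ∀ i ∈ s, pr i ∈ A))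
    (fun θ hθ => proj_ptype_mem_Hom_inf_Sp_pairs K _ A A.card hθ)
  rw [Hom_iInf_Kr_inf_Sp_pairs_inf_Sp_pure, Hom_iInf_Kr_inf_Sp_pairs_inf_Sp_nonpure K A q, Hom_univ_inf_Sp_pairs_eq] at h1
  rw [Hom_inf_Sp_pairs_inf_Sp_pure, Hom_univ_inf_Sp_pairs_eq, finrank_Hom_In, card_letters_eq] at h2
  have h3 := finrank_iInf_Kr_w_inf_Sp_pairs_add K A A.card q
  rw [Nat.choose_self, one_mul] at h3
  omega

/-- **THE PURE PIECES OF A JOINT KERNEL: `dim (Hom(univ,|A|) ⊓ ⋂_c Kr(univ, w_N q_c, |A|) ⊓ Sp(ptype = 𝟙_A)) + rank (hank K N |A| q) = 2^{|A|}`** for every finite family of classes,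
every set `A` of pairs and every field. -/
theorem finrank_iInf_Kr_w_inf_Sp_pure_add (A : Finset (Fin N)) (q : ι → ℕ → K) :
    finrank K ↥(Hom K (In N) (Finset.univ : Finset (In N)) A.card ⊓ (⨅ c, Kr K (Finset.univ : Finset (In N)) (w K N N (q c)) A.card)
        ⊓ Sp K (fun s : Finset (In N) => ptype s = fun c => if c ∈ A then 1 else 0))
      + (hank K N A.card (fun (_ : Unit) (c : ι) => q c)).rank = 2 ^ A.card := by
  rw [finrank_iInf_Kr_w_inf_Sp_pure_add_rank, finrank_Sp_pure]

/-- subtraction form: **`dim (Hom(univ,|A|) ⊓ ⋂_c Kr(univ, w_N q_c, |A|) ⊓ Sp(ptype = 𝟙_A)) = 2^{|A|} − rank (hank K N |A| q)`.** -/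
theorem finrank_iInf_Kr_w_inf_Sp_pure_eq (A : Finset (Fin N)) (q : ι → ℕ → K) :
    finrank K ↥(Hom K (In N) (Finset.univ : Finset (In N)) A.card ⊓ (⨅ c, Kr K (Finset.univ : Finset (In N)) (w K N N (q c)) A.card)
        ⊓ Sp K (fun s : Finset (In N) => ptype s = fun c => if c ∈ A then 1 else 0))
      = 2 ^ A.card - (hank K N A.card (fun (_ : Unit) (c : ι) => q c)).rank := by
  have h := finrank_iInf_Kr_w_inf_Sp_pure_add K A q
  omega

end Summit.Ventures.HSemireg.Wedge.HankelOuter
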